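import Summits.ResolutionOfSingularities.ResolutionOfSingularities.Theorems.HilbertSamuelEliminationSigmaMaxModificationsCorridor3WLadderLocalChainsTowers
import Summits.ResolutionOfSingularities.ResolutionOfSingularities.Theorems.HilbertSamuelEliminationSigmaMaxModificationsCorridor3WLadderLocalChainsDefs
import HarnessLib

/-!
# [OURS · L1 W4.2] (K) KILL ROW — local near-point chains with ISOLATED points on reduced excellent schemes of dimension `≤ 2`
# are finite: `localNearPointChainsTerminate_of_printedFacts : LocalChainPrintedFacts → LocalNearPointChainsTerminate`
# (crux chain w42 `SigmaMaxModificationsCorridor3` stmt-ResolutionOfSingularities-19249, card H `generic-point-descent`,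
# res-L1-w42-plan-1's W4.2 DEAL 2026-08-27 D6; `--supports stmt-ResolutionOfSingularities-19249`, helper)

OURS (cell res-hironaka, LADDER-RESOLUTION rung L, slot W4.2; seat res-D-pv-046 AS res-L1-s46-pv-9). NOT a statement of H. Hironaka's
manuscript [Hironaka2017] — nothing of it is used or asserted here. The row (res-L1-w42-idea-2 card H, typed VERBATIM by res-type-040
in `…Corridor3WLadderLocalChainsDefs.lean`, with res-L1-w42-tri-2's sharpened level clause `dim S_0 < N`) is CJS p. 98 Step 9 READ
ON THE LOCAL SCHEME as p. 107 directs: there is no infinite chain `(S_0, s_0) ← (S_1, s_1) ← ⋯` of local near-point steps (`S_i` local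
at `s_i`, `S_{i+1}` the local scheme of the blow-up of `S_i` in its closed point at a CLOSED NEAR point) with every `s_i` isolated in
the Hilbert–Samuel locus of `S_i`, for `S_0` excellent, reduced, of dimension `≤ 2` and `< N`. It is proved here from the SIX PRINTED
binders `LocalChainPrintedFacts` of Cossart–Jannsen–Saito [CossartJannsenSaito2020] / Kollár [Kollar2007] (the tree's named facts,
statement-only, taken BY NAME as the hypothesis of the row — two of them, `ProjDir_line` and `Kollar2007_thm_1_101_localChain`, are
meanwhile THEOREMS of the tree; the latter is not even used). AI-drafted, weaker than expert review. Sorry-free PROOF file, no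
definitions.

## The proof (CJS p. 98 Step 9 / p. 107; all scheme bookkeeping in the companions `…LocalChainsLocal`, `…LocalChainsTowers`)

* Along the chain, reducedness, Krull dimension `≤ 2`, `< N` and excellence of the local rings `𝒪_{S_i,s_i}` propagate STALK-WISE
  (`IsBlowup.isReduced_stalk_and_ringKrullDim_stalk_le`, Matsumura §32, the stalk isomorphisms behind `IsLocalSchemeAt`); the
  step centre is the reduced closed point (`eq_vanishingIdeal_singleton_of_isLocalAt`) and is PERMISSIBLE (else `𝔪 = 0` and the
  blow-up has no point over `s_i`); (F1) is automatic in dimension `≤ 2`.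
* `1 ≤ e_i` (Thm. 3.14, numerical form) and `e_i ≤ dim 𝒪 ≤ 2`; **`e = 1` is absorbing**: the near point lies on `ℙ(Dir)`
  (`Thm314_point_locus`), a single `κ`-rational point (`projDir_line`), so `e` does not increase (Thm. 3.10 (4),
  `dirDim_le_of_hsFun_eq_of_isIso_residueFieldMap`).
* If `e_{i₀} = 1` for some `i₀`: the tail globalises to ONE tower of point blow-ups over the LOCAL scheme `Spec 𝒪_{S_{i₀},s_{i₀}}`
  (`exists_localTower_isLocalAt`), an infinite fundamental sequence (Def. 6.34), which `Corollary637_char_loc` forbids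
  (`false_of_localTower_grade_one_loc`, res-L1-w42-stub-2's argument).
* Else `e_i = 2 = ē_i` for all `i`: the chain itself is a unit-wise localised chain of LENGTH-ONE fundamental units (Def. 6.38/6.39),
  which `KeyTheorem640_char_localized_isolated` forbids (`false_of_units_chain`).

## References

* V. Cossart, U. Jannsen, S. Saito, *Desingularization: Invariants and Strategy*, LNM 2270 (2020): p. 98 Step 9, Def. 3.1 (2),
  Thm. 3.10 (4), Thm. 3.14, Def. 6.34, Cor. 6.37, Def. 6.38, Def. 6.39, Thm. 6.40, p. 103, p. 107. [CossartJannsenSaito2020]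
* J. Kollár, *Lectures on Resolution of Singularities* (2007), Thm. 1.101 (binder only, unused). [Kollar2007]
* H. Matsumura, *Commutative Ring Theory* (1987), §32. [Matsumura1987]
-/

noncomputable section

-- namespace `…Corridor3.Moving` re-enters `…Corridor3` (module convention of the Moving files)
set_option linter.dupNamespace false

open CategoryTheory CategoryTheory.Limits AlgebraicGeometry TopologicalSpace IsLocalRing
open Literature.AlgebraicGeometry.Resolution Literature.RingTheory.HilbertSamuel
open Literature.AlgebraicGeometry.CossartJannsenSaito2020
open Scheme.IdealSheafData

universe u

namespace Summit.ResolutionOfSingularities.ResolutionOfSingularities.Theorems.SigmaMaxModificationsCorridor3.Moving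

/-! ## §7 THE KILL ROW -/

open LocalChains in
/-- **(K) KILL ROW — local near-point chains with ISOLATED points on reduced excellent schemes of dimension `≤ 2` are
finite** — the (K) KILL ROW of card H, W4.2 DEAL D6, VERBATIM over res-type-040's `LocalChainPrintedFacts` (the six PRINTED
binders: Cor. 6.37 local form, Thm. 6.40 unit-wise localised isolated form, Thm. 3.14 numerical form, Thm. 3.10 (4), Kollár 1.101
local-chain form, and — res-L1-w42-plan-1 ruling (α) 2026-08-27 — Thm. 3.14 in its point-centre LOCUS form `Thm314_point_locus`,
needed at `e = 1` for e-stability at the rational near point and for the recognition of the fundamental sequence; the numerical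
rendering only gives `1 ≤ e`). Proof = CJS p. 98 Step 9 read on
the local scheme (p. 107): `1 ≤ e_i ≤ 2` at every node (Thm. 3.14; a non-permissible point centre has an empty blow-up
fibre); `e = 1` is absorbing (Thm. 3.14 locus + `ℙ(Dir)` a rational point + Thm. 3.10 (4)); an `e ≡ 2` chain is a unit-wise
localised chain of length-one fundamental units (Thm. 6.40), an `e ≡ 1` tail globalises to an infinite fundamental sequence
over the local scheme `Spec 𝒪_{S_{i₀}}` (Cor. 6.37). The fifth binder `Kollar2007_thm_1_101_localChain` is not used.
[cite: CossartJannsenSaito2020, p. 98 Step 9, Thm. 3.14, Thm. 3.10 (4), Cor. 6.37, Def. 6.38, Thm. 6.40, p. 107] -/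
theorem localNearPointChainsTerminate_of_printedFacts : LocalChainPrintedFacts.{u} → LocalNearPointChainsTerminate.{u} := by
  intro hF N S ln pt hexc hred hdim2 hdimN' hchain hiso
  obtain ⟨hC637, hK640, h314, h3104, -, h314pt⟩ := hF
  have hdimN : topologicalKrullDim ↥(S 0) ≤ (N : WithBot ℕ∞) := hdimN'.le
  haveI := ln
  -- unpack the steps
  have hstep : ∀ i, ∃ (B : Scheme.{u}) (π : B ⟶ S i) (D : (S i).IdealSheafData) (b : B), IsLocalAt (S i) (pt i) ∧
      IsBlowup π D ∧ stalkIdeal D (pt i) = maximalIdeal ((S i).presheaf.stalk (pt i)) ∧ π.base b = pt i ∧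
      Scheme.hsFun B N b = Scheme.hsFun (S i) N (pt i) ∧ IsClosed ({b} : Set B) ∧
      IsLocalSchemeAt (S (i + 1)) (pt (i + 1)) B b := fun i => by
    obtain ⟨hl, B, π, D, b, h1, h2, h3, h4, h5, h6⟩ := hchain i
    exact ⟨B, π, D, b, hl, h1, h2, h3, h4, h5, h6⟩
  choose B π D b hloc hπD hD hb hH hbcl hS' using hstep
  have hcl : ∀ i, IsClosed ({pt i} : Set (S i)) := fun i => isClosed_singleton_of_isLocalAt (hloc i)
  have hπ : ∀ i, IsBlowup (π i) (vanishingIdeal ⟨{pt i}, hcl i⟩) := fun i =>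
    eq_vanishingIdeal_singleton_of_isLocalAt (hloc i) (hcl i) (hD i) ▸ hπD i
  haveI hBln : ∀ i, IsLocallyNoetherian (B i) := fun i => by
    haveI := (hπ i).isProper
    exact LocallyOfFiniteType.isLocallyNoetherian (π i)
  -- the links `𝒪_{S_{i+1}, s_{i+1}} ≅ 𝒪_{B_i, b_i}`
  have link : ∀ i, Nonempty ((S (i + 1)).presheaf.stalk (pt (i + 1)) ≅ (B i).presheaf.stalk (b i)) := fun i =>
    nonempty_stalkIso_of_isLocalSchemeAt (hS' i)
  -- reducedness of the local rings at the marked points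
  have hredst : ∀ i, _root_.IsReduced ((S i).presheaf.stalk (pt i)) := by
    intro i
    induction i with
    | zero => infer_instance
    | succ i ih =>
      have h1 : _root_.IsReduced ((B i).presheaf.stalk (b i)) :=
        ((hπ i).isReduced_stalk_and_ringKrullDim_stalk_le (b i)).1 (by rw [hb i]; exact ih)
      exact isReduced_of_injective (link i).some.commRingCatIsoToRingEquiv.toRingHom
        (link i).some.commRingCatIsoToRingEquiv.injective
  -- Krull dimension of the local rings at the marked points
  have hdimst : ∀ i, ringKrullDim ((S i).presheaf.stalk (pt i)) ≤ (2 : WithBot ℕ∞) ∧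
      ringKrullDim ((S i).presheaf.stalk (pt i)) ≤ (N : WithBot ℕ∞) := by
    intro i
    induction i with
    | zero =>
      rw [← topologicalKrullDim_eq_of_isLocalAt (hloc 0)]
      exact ⟨hdim2, hdimN⟩
    | succ i ih =>
      have h1 : ringKrullDim ((S (i + 1)).presheaf.stalk (pt (i + 1))) = ringKrullDim ((B i).presheaf.stalk (b i)) :=
        ringKrullDim_eq_of_ringEquiv (link i).some.commRingCatIsoToRingEquiv
      have h2 := (hπ i).ringKrullDim_stalk_le_of_isLocallyNoetherian (b i)
      rw [hb i] at h2
      rw [h1]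
      exact ⟨h2.trans ih.1, h2.trans ih.2⟩
  have hdimS : ∀ i, topologicalKrullDim (S i) ≤ (2 : WithBot ℕ∞) ∧ topologicalKrullDim (S i) ≤ (N : WithBot ℕ∞) :=
    fun i => by rw [topologicalKrullDim_eq_of_isLocalAt (hloc i)]; exact hdimst i
  -- excellence along the chain
  have hexcS : ∀ i, Scheme.IsExcellent (S i) := by
    intro i
    induction i with
    | zero => exact hexc
    | succ i ih =>
      haveI := (hπ i).isProper
      have hB : Scheme.IsExcellent (B i) := Scheme.IsExcellent.of_locallyOfFiniteType (π i) ih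
      have hR : IsExcellentRing ((S (i + 1)).presheaf.stalk (pt (i + 1))) :=
        IsExcellentRing.of_ringEquiv (link i).some.commRingCatIsoToRingEquiv.symm
          (isExcellentRing_stalk_of_isExcellent hB (b i))
      exact isExcellent_of_isLocalAt (hloc (i + 1)) hR
  -- (F1) is automatic in dimension `≤ 2`
  have hchar : ∀ i, CharHypothesis (S i) (pt i) := fun i => LocalChains.charHypothesis_of_dim_le_two (pt i) (hdimS i).1
  -- every point centre of the chain is permissible, and `1 ≤ e ≤ 2` at every node
  have hperm : ∀ i, IdealSheafData.IsPermissible (vanishingIdeal (⟨{pt i}, hcl i⟩ : Closeds (S i))) := fun i => by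
    haveI := hredst i
    exact isPermissible_singleton_of_over (hcl i) (hπ i) (hb i)
  have he1 : ∀ i, 1 ≤ Scheme.dirDim (S i) (pt i) := fun i =>
    one_le_dirDim_of_near h314 (hexcS i) (hdimS i).2 (hcl i) (hπ i) (hperm i) (hchar i) (hb i) (hH i)
  have he2 : ∀ i, Scheme.dirDim (S i) (pt i) ≤ 2 := fun i => by
    have := (Scheme.natCast_dirDim_le_ringKrullDim_stalk (X := S i) (pt i)).trans (hdimst i).1
    exact_mod_cast this
  have heB : ∀ i, Scheme.dirDim (S (i + 1)) (pt (i + 1)) = Scheme.dirDim (B i) (b i) := fun i =>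
    dirDim_eq_of_nonempty_stalkIso (link i)
  have hēB : ∀ i, Scheme.geomDirDim (S (i + 1)) (pt (i + 1)) = Scheme.geomDirDim (B i) (b i) := fun i =>
    geomDirDim_eq_of_nonempty_stalkIso (link i)
  -- `e = 1` is ABSORBING: the near point lies on `ℙ(Dir)`, a single rational point, and `e` does not increase at a
  -- rational near point (Thm. 3.14 locus form, `projDir_line`, Thm. 3.10 (4))
  have habs : ∀ i, Scheme.dirDim (S i) (pt i) = 1 → Scheme.dirDim (S (i + 1)) (pt (i + 1)) = 1 := by
    intro i hi
    rw [heB i]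
    have onDir : IsOnProjDirectrix (π i) (b i) :=
      h314pt (S i) (B i) (π i) (pt i) (hcl i) N (b i) (hexcS i) (hperm i) (hπ i) (hdimS i).2 (hb i) (hchar i) (hH i)
    have hmem : b i ∈ projDirectrixFibre (π i) (pt i) := (mem_projDirectrixFibre _ _ _).mpr ⟨hb i, onDir⟩
    haveI : IsIso ((π i).residueFieldMap (b i)) :=
      (projDir_line (S i) (B i) (π i) (pt i) (hcl i) (hπ i) hi).2 (b i) hmem
    have hsupp : (π i).base (b i) ∈ ((vanishingIdeal (⟨{pt i}, hcl i⟩ : Closeds (S i))).support : Set (S i)) := by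
      rw [Scheme.IdealSheafData.coe_support_vanishingIdeal, hb i]; exact Set.mem_singleton _
    have hle := dirDim_le_of_hsFun_eq_of_isIso_residueFieldMap h3104 (hexcS i) (hperm i) (hπ i) (hdimS i).2 hsupp
      (by rw [hb i]; exact hH i)
    rw [hb i, hi] at hle
    have h1 : 1 ≤ Scheme.dirDim (B i) (b i) := heB i ▸ he1 (i + 1)
    omega
  by_cases hex : ∃ i, Scheme.dirDim (S i) (pt i) = 1
  · -- an `e ≡ 1` tail from `i₀`: Cor. 6.37 on the globalised tower over `Spec 𝒪_{S_{i₀}}`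
    obtain ⟨i₀, hi₀⟩ := hex
    have htail : ∀ j, Scheme.dirDim (S (i₀ + j)) (pt (i₀ + j)) = 1 := by
      intro j
      induction j with
      | zero => exact hi₀
      | succ j ih => exact habs (i₀ + j) ih
    -- the globalised tower of the tail
    obtain ⟨T, y, hC, hycl, hover, hst, hkeyT, hcharT, hlocT, hisoT⟩ :=
      exists_localTower_isLocalAt (W := fun j => S (i₀ + j)) (W' := fun j => B (i₀ + j)) (fun j => π (i₀ + j))
        (fun j => vanishingIdeal ⟨{pt (i₀ + j)}, hcl (i₀ + j)⟩) (fun j => hπ (i₀ + j))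
        (fun j => vanishingIdeal_eq_vanishingIdeal_support _) (fun j => pt (i₀ + j))
        (fun j => stalkIdeal_vanishingIdeal_singleton (hcl (i₀ + j))) (fun j => b (i₀ + j)) (fun j => hb (i₀ + j))
        (fun j => hbcl (i₀ + j)) (fun j => ⟨(link (i₀ + j)).some.symm⟩)
    haveI : ∀ j, IsLocallyNoetherian (T.X j) := T.ln
    have hkey : KeySetting T N := hkeyT N (hexcS i₀) (hdimS i₀).2
    -- invariants along the tower, read through the stalk isomorphisms
    have hHS : ∀ j, Scheme.hsFun (S (i₀ + j)) N (pt (i₀ + j)) = Scheme.hsFun (S i₀) N (pt i₀) := by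
      intro j
      induction j with
      | zero => rfl
      | succ j ih =>
        show Scheme.hsFun (S (i₀ + j + 1)) N (pt (i₀ + j + 1)) = _
        rw [← ih, hsFun_eq_of_nonempty_stalkIso (link (i₀ + j)) N, hH (i₀ + j)]
    have hHT : ∀ j, Scheme.hsFun (T.X j) N (y j) = Scheme.hsFun (T.X 0) N (y 0) := fun j => by
      rw [hsFun_eq_of_nonempty_stalkIso (hst j) N, hsFun_eq_of_nonempty_stalkIso (hst 0) N]
      exact hHS j
    have heT : ∀ j, @Scheme.dirDim (T.X j) (T.ln j) (y j) = 1 := fun j => by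
      rw [dirDim_eq_of_nonempty_stalkIso (hst j)]; exact htail j
    have hpS : ∀ j, ringChar (ResidueField ((S (i₀ + j)).presheaf.stalk (pt (i₀ + j)))) =
        ringChar (ResidueField ((S i₀).presheaf.stalk (pt i₀))) := by
      intro j
      induction j with
      | zero => rfl
      | succ j ih =>
        show ringChar (ResidueField ((S (i₀ + j + 1)).presheaf.stalk (pt (i₀ + j + 1)))) = _
        rw [← ih, ringChar_residueField_eq_of_stalkIso (link (i₀ + j)).some, Helpers.ringChar_residueField_eq_of_hom' (π (i₀ + j)),
          hb (i₀ + j)]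
    have hpT : ∀ j, ringChar (ResidueField ((T.X j).presheaf.stalk (y j))) =
        ringChar (ResidueField ((T.X 0).presheaf.stalk (y 0))) := fun j => by
      rw [ringChar_residueField_eq_of_stalkIso (hst j).some, ringChar_residueField_eq_of_stalkIso (hst 0).some]
      exact hpS j
    have hisol : @IsIsolatedInHSMaxLocus (T.X 0) (T.ln 0) N (y 0) :=
      hisoT N (isIsolatedInHSMaxLocus_spec_of_isLocalAt (hloc i₀) (hiso i₀))
    exact false_of_localTower_grade_one_loc h314pt hC637 T y hC hycl hover hkey hlocT (hcharT (hchar i₀)) hisol hHT heT hpT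
  · -- `e ≡ 2` (hence `ē ≡ 2`): a unit-wise localised chain of length-one fundamental units, Thm. 6.40
    push Not at hex
    have he2' : ∀ i, Scheme.dirDim (S i) (pt i) = 2 := fun i => by
      have := he1 i; have := he2 i; have := hex i; omega
    have hē2 : ∀ i, Scheme.geomDirDim (S i) (pt i) = 2 := fun i => by
      have h1 := Scheme.dirDim_le_geomDirDim (X := S i) (pt i)
      have h2 : Scheme.geomDirDim (S i) (pt i) ≤ 2 := by
        have := (Scheme.natCast_geomDirDim_le_ringKrullDim_stalk (X := S i) (pt i)).trans (hdimst i).1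
        exact_mod_cast this
      have := he2' i
      omega
    exact false_of_units_chain hK640 S B π pt b hcl hπ hb hbcl hH hS' (hloc 0) hexc hdimN (hchar 0) hperm he2' hē2
      (fun i => (heB i) ▸ he2' (i + 1)) (fun i => (hēB i) ▸ hē2 (i + 1)) hiso

end Summit.ResolutionOfSingularities.ResolutionOfSingularities.Theorems.SigmaMaxModificationsCorridor3.Moving

end
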